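import Mathlib
import HarnessLib
import Summits.Parity.GeneralizedHardyLittlewood.Theorems.DilatedChowla.Negative.DilatedChowlaMirrorOnePointDefs

/-!
# `DilatedChowla` (stmt-Parity-13319): the orthogonality step of the mirror line

Part of the analytic stub of the line `Sketch` (card `siegel-mirror`) for the crux
`LiouvilleMAD.DilatedChowla`.  This file passes from the per-character exceptional-zero law
`CharTwistLaw c₁ C₁ C₂` (for the twisted Liouville sums `B Ξ y = Σ_{1 ≤ u ≤ y} λ(u) Ξ(u)`) to the
unit-class law `OnePointExcLaw c₁ C₁ C₂` (for `T k y = Σ_{1 ≤ u ≤ y, u ≡ 1 (mod k)} λ(u)`), at the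
same constants, by orthogonality of Dirichlet characters:

`φ(k) · T k y = Σ_{Ξ mod k} B Ξ y`

(Mathlib `DirichletCharacter.sum_characters_eq`), the count `#{Ξ mod k} = φ(k)`
(`DirichletCharacter.card_eq_totient_of_hasEnoughRootsOfUnity`), and the triangle inequality:
summing the `φ(k)` per-character errors `(R+1) y/k⁴` and dividing by `φ(k) ≥ 1` gives the
unit-class error `(R+1) y/k⁴ ≤ (R+1) y/k³`.

Main results: `onePointExcLaw_of_charTwistLaw`, and the packaged `onePointExc_of_charTwist'`
(`CharTwist → OnePointExc`).
-/

noncomputable section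

namespace Summit.Parity.GeneralizedHardyLittlewood.Theorems.DilatedChowla.Negative

open Finset
open scoped Classical

/-- A natural number `u` reduces to `1` in `ZMod k` iff `u ≡ 1 (mod k)`. -/
theorem orth_natCast_eq_one_iff (k u : ℕ) : ((u : ZMod k) = 1) ↔ u ≡ 1 [MOD k] := by
  rw [← ZMod.natCast_eq_natCast_iff, Nat.cast_one]

/-- **Orthogonality.**  `φ(k) · T k y = Σ_{Ξ mod k} B Ξ y`: summing the twisted Liouville sums over
all Dirichlet characters mod `k` detects the unit class `u ≡ 1 (mod k)`. -/
theorem orth_totient_mul_T_eq (k : ℕ) [NeZero k] (y : ℝ) :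
    (Nat.totient k : ℂ) * ((T k y : ℝ) : ℂ) = ∑ Ξ : DirichletCharacter ℂ k, B Ξ y := by
  unfold T B
  conv_rhs => rw [Finset.sum_comm]
  simp_rw [← Finset.mul_sum, DirichletCharacter.sum_characters_eq]
  rw [Complex.ofReal_sum, Finset.sum_filter, Finset.mul_sum]
  refine Finset.sum_congr rfl fun u _ => ?_
  by_cases hu : u ≡ 1 [MOD k]
  · rw [if_pos hu, if_pos ((orth_natCast_eq_one_iff k u).mpr hu)]
    push_cast
    ring
  · rw [if_neg hu, if_neg (mt (orth_natCast_eq_one_iff k u).mp hu)]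
    simp

/-- **Orthogonality step: the per-character law implies the unit-class law** (same constants).
Given the exceptional zero `β` of the real character `ψ mod k`, take the main-term constant `R`
supplied by `CharTwistLaw`; then `φ(k) T k y − R y^β/β = Σ_Ξ (B Ξ y − [Ξ = ψ] R y^β/β)` has norm at
most `φ(k) (R+1) y/k⁴`, whence `|T k y − R y^β/(φ(k) β)| ≤ (R+1) y/k⁴ ≤ (R+1) y/k³`. -/
theorem onePointExcLaw_of_charTwistLaw {c₁ C₁ C₂ : ℝ} (h : CharTwistLaw c₁ C₁ C₂) :
    OnePointExcLaw c₁ C₁ C₂ := by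
  intro k _ ψ hψ hψ2 β hβ hβ1 hL
  obtain ⟨R, hR, hB⟩ := h k ψ hψ hψ2 β hβ hβ1 hL
  refine ⟨R, hR, fun y hy => ?_⟩
  have hkpos : (0 : ℝ) < k := by exact_mod_cast NeZero.pos k
  have hk1 : (1 : ℝ) ≤ k := by exact_mod_cast NeZero.one_le
  have hφpos : (0 : ℝ) < (Nat.totient k : ℝ) := by
    exact_mod_cast Nat.totient_pos.mpr (NeZero.pos k)
  have hφne : (Nat.totient k : ℝ) ≠ 0 := hφpos.ne'
  -- the difference `φ(k) T - R y^β/β` as a sum over characters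
  have hsum : (Nat.totient k : ℂ) * ((T k y : ℝ) : ℂ) - ((R * y ^ β / β : ℝ) : ℂ) =
      ∑ Ξ : DirichletCharacter ℂ k,
        (B Ξ y - (if Ξ = ψ then ((R * y ^ β / β : ℝ) : ℂ) else 0)) := by
    rw [Finset.sum_sub_distrib, orth_totient_mul_T_eq, Finset.sum_ite_eq',
      if_pos (Finset.mem_univ _)]
  -- triangle inequality over the `φ(k)` characters
  -- (`#{Ξ mod k} = φ(k)`: `DirichletCharacter.card_eq_totient_of_hasEnoughRootsOfUnity`)
  have hbound : ‖(Nat.totient k : ℂ) * ((T k y : ℝ) : ℂ) - ((R * y ^ β / β : ℝ) : ℂ)‖ ≤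
      (Nat.totient k : ℝ) * ((R + 1) * y / (k : ℝ) ^ 4) := by
    rw [hsum]
    refine (norm_sum_le _ _).trans ?_
    calc ∑ Ξ : DirichletCharacter ℂ k,
          ‖B Ξ y - (if Ξ = ψ then ((R * y ^ β / β : ℝ) : ℂ) else 0)‖
        ≤ ∑ _Ξ : DirichletCharacter ℂ k, (R + 1) * y / (k : ℝ) ^ 4 :=
          Finset.sum_le_sum fun Ξ _ => hB Ξ y hy
      _ = (Nat.totient k : ℝ) * ((R + 1) * y / (k : ℝ) ^ 4) := by
          rw [Finset.sum_const, Finset.card_univ, ← Nat.card_eq_fintype_card,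
            DirichletCharacter.card_eq_totient_of_hasEnoughRootsOfUnity ℂ k, nsmul_eq_mul]
  -- the left-hand side is the norm of a real number
  have hreal : |(Nat.totient k : ℝ) * T k y - R * y ^ β / β| ≤
      (Nat.totient k : ℝ) * ((R + 1) * y / (k : ℝ) ^ 4) := by
    have hcast : (Nat.totient k : ℂ) * ((T k y : ℝ) : ℂ) - ((R * y ^ β / β : ℝ) : ℂ) =
        (((Nat.totient k : ℝ) * T k y - R * y ^ β / β : ℝ) : ℂ) := by
      push_cast
      ring
    rw [hcast, Complex.norm_real, Real.norm_eq_abs] at hbound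
    exact hbound
  -- the error constant `(R + 1) y` is non-negative (it dominates a norm)
  have hnn : 0 ≤ (R + 1) * y := by
    by_contra hneg
    have hlt : (R + 1) * y < 0 := not_le.mp hneg
    have : (Nat.totient k : ℝ) * ((R + 1) * y / (k : ℝ) ^ 4) < 0 :=
      mul_neg_of_pos_of_neg hφpos (div_neg_of_neg_of_pos hlt (pow_pos hkpos 4))
    linarith [abs_nonneg ((Nat.totient k : ℝ) * T k y - R * y ^ β / β)]
  -- divide by `φ(k)`
  have key : |T k y - R * y ^ β / ((Nat.totient k : ℝ) * β)| ≤ (R + 1) * y / (k : ℝ) ^ 4 := by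
    have hTeq : T k y - R * y ^ β / ((Nat.totient k : ℝ) * β) =
        ((Nat.totient k : ℝ) * T k y - R * y ^ β / β) / (Nat.totient k : ℝ) := by
      rw [sub_div, mul_div_cancel_left₀ _ hφne, mul_comm (Nat.totient k : ℝ) β, ← div_div]
    rw [hTeq, abs_div, abs_of_pos hφpos, div_le_iff₀ hφpos]
    calc |(Nat.totient k : ℝ) * T k y - R * y ^ β / β|
        ≤ (Nat.totient k : ℝ) * ((R + 1) * y / (k : ℝ) ^ 4) := hreal
      _ = (R + 1) * y / (k : ℝ) ^ 4 * (Nat.totient k : ℝ) := by ring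
  -- weaken `k⁴` to `k³`
  calc |T k y - R * y ^ β / ((Nat.totient k : ℝ) * β)|
      ≤ (R + 1) * y / (k : ℝ) ^ 4 := key
    _ ≤ (R + 1) * y / (k : ℝ) ^ 3 :=
        div_le_div_of_nonneg_left hnn (pow_pos hkpos 3) (pow_le_pow_right₀ hk1 (by norm_num))

/-- **`CharTwist → OnePointExc`**: the per-character law with some positive constants implies the
unit-class law with the same constants (`onePointExcLaw_of_charTwistLaw` packaged through
`onePointExc_of_charTwist`). -/
theorem onePointExc_of_charTwist' (h : CharTwist) : OnePointExc :=
  onePointExc_of_charTwist (fun _ _ _ _ _ _ hlaw => onePointExcLaw_of_charTwistLaw hlaw) h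

end Summit.Parity.GeneralizedHardyLittlewood.Theorems.DilatedChowla.Negative

end
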